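import Mathlib.Analysis.SpecialFunctions.Gaussian.GaussianIntegral
import Mathlib.Analysis.SpecialFunctions.Pow.Deriv
import Mathlib.Analysis.SpecialFunctions.Integrals.Basic
import HarnessLib

/-!
# The rotated Schläfli kernel `P(z) = ∫₀^∞ e^{-w} w^{-1/2} (w + 2z)^{-1/2} dw` (towards Zhou's B³G sum rule)

Topic `Literature/Analysis/FunctionSpaces`, first of the sibling files proving the named fact
`Zhou2017_B3G_sumRule` of `BesselMoments.lean` (Y. Zhou, *Hilbert transforms and sum rules of
Bessel moments*, Ramanujan J. 48 (2019), arXiv:1706.01068, **Thm. 3.3**: `Z_{2n,n-2k} = 0` for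
`n ≥ 2k ≥ 2`). This file holds the DEFINITIONS only (plus their unfolding / positivity /
measurability API); all estimates and the proof are in the theorem-only siblings
`BesselMomentsKernelBounds`, `…KernelAnalytic`, `…Boundary`, `…Decay`, `…Proofs`.

## The argument being formalized

Zhou's proof (pp. 4–5): the "Hilbert ladders" `ζ_ℓ + iη_ℓ = (-i)^ℓ [κ(κ + iι sgn)]^ℓ`
(`ι = πI₀`, `κ(x) = K₀(|x|)`) satisfy `H ζ_ℓ = η_ℓ`, `H(ζ_ℓ ϖ_j) = η_ℓ ϖ_j` for `j < ℓ`
(Prop. 3.2, from `Hι_± = ∓κ_±`, `Hκ_± = ±ι_±`, Lemma 2.2, King's tables), whence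
`∫_ℝ ζ_n(x) xʲ dx = 0` for `0 ≤ j ≤ n - 2`, which is `Z_{2n,n-2k} = 0` by binomial expansion
(Thm. 3.3). The statement "`f + iHf` for these `f`" is the statement that `κ(κ + iι sgn)` is the
boundary value on `ℝ` of the function `K₀(z)K₀(-z)`, holomorphic on the upper half-plane `ℍ`
(`K₀(xe^{±iπ}) = K₀(x) ∓ iπI₀(x)`), and the moment vanishing is Cauchy's theorem for
`[K₀(z)K₀(-z)]ⁿ zʲ = O(|z|^{j-n})`. Mathlib has no `L^p` Hilbert transform (M. Riesz,
Hardy–Poincaré–Bertrand), so we run the argument in this equivalent contour form, with every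
analytic input proved from scratch:

* `P(z) := ∫₀^∞ e^{-w} w^{-1/2} (w + 2z)^{-1/2} dw` (principal branch; `zhouP`). For `x > 0`,
  `P(x) = eˣ K₀(x)` by `w = x(cosh t - 1)` in the tree's `K₀(x) = ∫₀^∞ e^{-x cosh t} dt`
  (this is DLMF 10.32.8 at `ν = 0` after `t = 1 + w/x`), and `P(-r) = e^{-r}(K₀(r) - iπI₀(r))`
  (`r > 0`; on `w < 2r` the principal branch gives `(w - 2r)^{-1/2} = -i(2r - w)^{-1/2}` and
  `w = r(1 - cos θ)` produces `πI₀`). So `P` is `e^{z}K₀(z)` on the closed upper half-plane,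
  cut included (`BesselMomentsBoundary`).
* `|w + 2z| ≥ |w - 2|z||` gives the majorant `m_ρ(w) = e^{-w}w^{-1/2}|w - 2ρ|^{-1/2}` (`zhouMajorant`)
  with `∫ m_ρ ≤ √3 Γ(η) ρ^{-η} + 4e^{-ρ}` (`0 < η ≤ 1/2`): `‖P(z)‖ = O(|z|^{-1/2})` at `∞` and
  `O(|z|^{-η})` at `0` (`BesselMomentsKernelBounds`); `P` is holomorphic off `ℝ` and continuous
  onto `ℝ ∖ {0}` along verticals (`BesselMomentsKernelAnalytic`).
* `F(z) := P(z) · conj P(-conj z)` (`zhouF`; `= K₀(z)K₀(-z)` on `ℍ`, the factors `e^{∓z}`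
  cancel, and `F(x) = K₀(x)(K₀(x) + iπI₀(x))`, `F(-x) = conj F(x)` for `x > 0`),
  `G_{n,j} := Fⁿ zʲ` (`zhouG`): Cauchy on `[-R,R] × [δ,T]`, `R, T → ∞`, `δ → 0⁺` give
  `∫_ℝ G_{n,j} = 0` for `j + 2 ≤ n` (`BesselMomentsDecay`, `BesselMomentsProofs`), and
  `G_{n,j}(t) + G_{n,j}(-t) = 2iⁿ Σ_m (-1)ᵐ C(n,2m) (πI₀)^{n-2m} K₀^{n+2m} tʲ` for `j ≡ n (2)`
  is `2iⁿ` times the integrand of `zhouZ n j` (`BesselMomentsProofs`,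
  `Zhou2017_B3G_sumRule_holds`).

## References

* [Zhou2017] Y. Zhou, Hilbert transforms and sum rules of Bessel moments, Ramanujan J. 48 (2019)
  159–172, arXiv:1706.01068 — Lemma 2.2, Prop. 3.2, Thm. 3.3 (pp. 4–5 of the arXiv version).
* [DLMF] NIST Digital Library of Mathematical Functions, §10.32 (10.32.8, 10.32.9), §10.34 (10.34.2).
-/

noncomputable section

open MeasureTheory Set Filter
open scoped Topology ComplexConjugate

namespace Literature.Analysis.FunctionSpaces

/-! ### The weight, the kernel and `P` -/

/-- The weight `k(w) = e^{-w} w^{-1/2}` of the rotated Schläfli integral. [folklore] -/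
def zhouWeight (w : ℝ) : ℝ := Real.exp (-w) * w ^ (-(1 / 2 : ℝ))

/-- `k(w) ≥ 0` for `w ≥ 0`. [folklore] -/
theorem zhouWeight_nonneg {w : ℝ} (hw : 0 ≤ w) : 0 ≤ zhouWeight w :=
  mul_nonneg (Real.exp_pos _).le (Real.rpow_nonneg hw _)

/-- `∫₀^∞ e^{-w} w^{η-1} dw` converges (`η > 0`; Euler's integral). [folklore] -/
theorem integrableOn_exp_neg_mul_rpow {η : ℝ} (hη : 0 < η) :
    IntegrableOn (fun w : ℝ => Real.exp (-w) * w ^ (η - 1)) (Ioi 0) :=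
  Real.GammaIntegral_convergent hη

/-- `k` is integrable on `(0, ∞)`. [folklore] -/
theorem integrableOn_zhouWeight : IntegrableOn zhouWeight (Ioi 0) := by
  have h := Real.GammaIntegral_convergent (s := 1 / 2) (by norm_num)
  refine h.congr_fun (fun w _ => ?_) measurableSet_Ioi
  simp only [zhouWeight]
  norm_num

/-- `∫₀^∞ k = Γ(1/2) = √π`. [folklore] -/
theorem integral_zhouWeight : ∫ w in Ioi (0 : ℝ), zhouWeight w = Real.sqrt Real.pi := by
  rw [← Real.Gamma_one_half_eq, Real.Gamma_eq_integral (by norm_num : (0 : ℝ) < 1 / 2)]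
  refine setIntegral_congr_fun measurableSet_Ioi fun w _ => ?_
  simp only [zhouWeight]
  norm_num

/-- The integrand with a general coefficient: `k(w) (w + c z)^{-1/2}`, principal branch (`c = 2`
gives `P`, `c = -2` the conjugate kernel `∫ k(w)(w - 2z)^{-1/2}`). [folklore] -/
def zhouIntegrandC (c z : ℂ) (w : ℝ) : ℂ :=
  (zhouWeight w : ℂ) * ((w : ℂ) + c * z) ^ (((-(1 / 2) : ℝ)) : ℂ)

/-- The integrand of `P`: `k(w) (w + 2z)^{-1/2}` (principal branch). [folklore] -/
def zhouIntegrand (z : ℂ) (w : ℝ) : ℂ :=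
  (zhouWeight w : ℂ) * ((w : ℂ) + 2 * z) ^ (((-(1 / 2) : ℝ)) : ℂ)

/-- **`P(z) = ∫₀^∞ e^{-w} w^{-1/2} (w + 2z)^{-1/2} dw`** (principal branch of the square root; a
Bochner integral over `(0, ∞)`, absolutely convergent for every `z ≠ 0`). For `x > 0` this is
`eˣ K₀(x)` (DLMF 10.32.8 at `ν = 0`), and on the negative axis it is the upper boundary value
`e^{z}K₀(z)|_{z = -r + i0} = e^{-r}(K₀(r) - iπ I₀(r))` — both proved in
`BesselMomentsBoundary.lean`. [folklore] -/
def zhouP (z : ℂ) : ℂ := ∫ w in Ioi (0 : ℝ), zhouIntegrand z w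

/-- `zhouIntegrand = zhouIntegrandC 2`. [folklore] -/
theorem zhouIntegrand_eq (z : ℂ) (w : ℝ) : zhouIntegrand z w = zhouIntegrandC 2 z w := rfl

/-- `P z = ∫ zhouIntegrandC 2 z`. [folklore] -/
theorem zhouP_eq (z : ℂ) : zhouP z = ∫ w in Ioi (0 : ℝ), zhouIntegrandC 2 z w := rfl

/-- Measurability of the integrand of `P` in `w`. [folklore] -/
theorem measurable_zhouIntegrand (z : ℂ) : Measurable (zhouIntegrand z) := by
  unfold zhouIntegrand zhouWeight
  fun_prop

/-- Measurability of the general integrand in `w`. [folklore] -/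
theorem measurable_zhouIntegrandC (c z : ℂ) : Measurable (zhouIntegrandC c z) := by
  unfold zhouIntegrandC zhouWeight
  fun_prop

/-- `‖k(w)(w+2z)^{-1/2}‖ = k(w) ‖w + 2z‖^{-1/2}` (`w ≥ 0`). [folklore] -/
theorem norm_zhouIntegrand (z : ℂ) {w : ℝ} (hw : 0 ≤ w) :
    ‖zhouIntegrand z w‖ = zhouWeight w * ‖(w : ℂ) + 2 * z‖ ^ (-(1 / 2) : ℝ) := by
  rw [zhouIntegrand, norm_mul, Complex.norm_real, Real.norm_of_nonneg (zhouWeight_nonneg hw),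
    Complex.norm_cpow_real]

/-- **The key inequality** `|w - 2‖z‖| ≤ ‖w + 2z‖` (`w ≥ 0`):
`‖w + 2z‖² - (w - 2|z|)² = 4w(Re z + |z|) ≥ 0`. [folklore] -/
theorem abs_sub_two_mul_norm_le {w : ℝ} (hw : 0 ≤ w) (z : ℂ) :
    |w - 2 * ‖z‖| ≤ ‖(w : ℂ) + 2 * z‖ := by
  refine abs_le_of_sq_le_sq ?_ (norm_nonneg _)
  rw [Complex.sq_norm, Complex.normSq_apply]
  simp only [Complex.add_re, Complex.ofReal_re, Complex.mul_re, Complex.re_ofNat,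
    Complex.im_ofNat, zero_mul, sub_zero, Complex.add_im, Complex.ofReal_im, Complex.mul_im,
    add_zero, zero_add]
  have h1 : -‖z‖ ≤ z.re := (abs_le.1 (Complex.abs_re_le_norm z)).1
  have h2 : ‖z‖ ^ 2 = z.re * z.re + z.im * z.im := by
    rw [Complex.sq_norm, Complex.normSq_apply]
  nlinarith

/-! ### The majorant -/

/-- The majorant `m_ρ(w) = k(w) |w - 2ρ|^{-1/2}` of the integrand of `P(z)` on `‖z‖ = ρ`
(junk `k(w)·0` at the single point `w = 2ρ`, where `Real.rpow 0 (-1/2) = 0`). [folklore] -/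
def zhouMajorant (ρ w : ℝ) : ℝ := zhouWeight w * |w - 2 * ρ| ^ (-(1 / 2) : ℝ)

/-- `m_ρ ≥ 0` on `w ≥ 0`. [folklore] -/
theorem zhouMajorant_nonneg (ρ : ℝ) {w : ℝ} (hw : 0 ≤ w) : 0 ≤ zhouMajorant ρ w :=
  mul_nonneg (zhouWeight_nonneg hw) (Real.rpow_nonneg (abs_nonneg _) _)

/-- The majorant is measurable. [folklore] -/
theorem measurable_zhouMajorant (ρ : ℝ) : Measurable (zhouMajorant ρ) := by
  unfold zhouMajorant zhouWeight
  fun_prop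

/-- Domination `‖k(w)(w+2z)^{-1/2}‖ ≤ m_{‖z‖}(w)` off the single point `w = 2‖z‖`. [folklore] -/
theorem norm_zhouIntegrand_le {z : ℂ} {w : ℝ} (hw : 0 ≤ w) (hw' : w ≠ 2 * ‖z‖) :
    ‖zhouIntegrand z w‖ ≤ zhouMajorant ‖z‖ w := by
  rw [norm_zhouIntegrand z hw, zhouMajorant]
  refine mul_le_mul_of_nonneg_left ?_ (zhouWeight_nonneg hw)
  have hpos : 0 < |w - 2 * ‖z‖| := abs_pos.2 (sub_ne_zero.2 hw')
  exact Real.rpow_le_rpow_of_nonpos hpos (abs_sub_two_mul_norm_le hw z) (by norm_num)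

/-- The same domination, almost everywhere on `(0, ∞)`. [folklore] -/
theorem ae_norm_zhouIntegrand_le (z : ℂ) :
    ∀ᵐ w ∂(volume.restrict (Ioi (0 : ℝ))), ‖zhouIntegrand z w‖ ≤ zhouMajorant ‖z‖ w := by
  have h1 : ∀ᵐ w ∂(volume.restrict (Ioi (0 : ℝ))), w ≠ 2 * ‖z‖ :=
    ae_restrict_of_ae (Measure.ae_ne volume _)
  have h2 : ∀ᵐ w ∂(volume.restrict (Ioi (0 : ℝ))), w ∈ Ioi (0 : ℝ) :=
    ae_restrict_mem measurableSet_Ioi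
  filter_upwards [h1, h2] with w hw1 hw2
  exact norm_zhouIntegrand_le (le_of_lt hw2) hw1

/-! ### `F = P · conj P(-conj ·)` and `G_{n,j} = Fⁿ zʲ` -/

/-- **`F(z) := P(z) · conj P(-conj z)`**: on the open upper half-plane this is `K₀(z) K₀(-z)`
(the factors `e^{∓z}` cancel), on the real axis it is its boundary value from above,
`F(x) = K₀(x)(K₀(x) + iπ I₀(x))` and `F(-x) = conj F(x)` for `x > 0`
(`BesselMomentsBoundary.lean`). [folklore] -/
def zhouF (z : ℂ) : ℂ := zhouP z * conj (zhouP (-conj z))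

/-- **`G_{n,j}(z) := F(z)ⁿ zʲ`**, the integrand of the contour argument. [folklore] -/
def zhouG (n j : ℕ) (z : ℂ) : ℂ := zhouF z ^ n * z ^ j

/-- `‖F z‖ = ‖P z‖ ‖P(-conj z)‖`. [folklore] -/
theorem norm_zhouF_eq (z : ℂ) : ‖zhouF z‖ = ‖zhouP z‖ * ‖zhouP (-conj z)‖ := by
  rw [zhouF, norm_mul, Complex.norm_conj]

/-- `‖G_{n,j} z‖ = ‖F z‖ⁿ ‖z‖ʲ`. [folklore] -/
theorem norm_zhouG_eq (n j : ℕ) (z : ℂ) : ‖zhouG n j z‖ = ‖zhouF z‖ ^ n * ‖z‖ ^ j := by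
  rw [zhouG, norm_mul, norm_pow, norm_pow]

end Literature.Analysis.FunctionSpaces
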